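import Mathlib
import Summits.Ventures.PercRepro2.Defs
import Summits.Ventures.PercRepro2.Independence
import Summits.Ventures.PercRepro2.Harris
import Summits.Ventures.PercRepro2.Graph
import Summits.Ventures.PercRepro2.Exploration
import Summits.Ventures.PercRepro2.Events
import Summits.Ventures.PercRepro2.Statements
import Summits.Ventures.PercRepro2.FourFunctions
import Summits.Ventures.PercRepro2.Induced
import Summits.Ventures.PercRepro2.Frontier
import Summits.Ventures.PercRepro2.ObsIndependence
import Summits.Ventures.PercRepro2.BHK
import Summits.Ventures.PercRepro2.BHKEvents
import Summits.Ventures.PercRepro2.OrderPreservation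
import Summits.Ventures.PercRepro2.ClusterProperty
import Summits.Ventures.PercRepro2.OrderPreservationFun
import Summits.Ventures.PercRepro2.KNTwo
import Summits.Ventures.PercRepro2.KNGeneral

/-!
# Kozma–Nitzan Theorems 1 and 7 as corollaries of order preservation
(blind cell PercRepro2, p1; proofs/LEAD-PROOFSHAPES.md §10)

The second, shorter route. With `A = {a₁, a₂}` and `{v ↔ A} = {v ↔ a₁} ∪ {v ↔ a₂}`, inclusion–exclusion
gives `P(v↔A, a₁↔b) = P(v↔a₁, a₁↔b) + P(v↔a₂, a₁↔b) − P(v↔a₁, v↔a₂, a₁↔b)`; the first and third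
terms equal the corresponding terms with `v ↔ b` (same cluster on `{v ↔ a₁}`), and the middle term is
bounded by `P(v↔a₂, a₂↔b) = P(v↔a₂, v↔b)` by **R10 at the root `a₂`** (`orderPreserving_conn` with
the up-set `{W | v ∈ W}`) as soon as `P(a₁↔b) ≤ P(a₂↔b)`. Hence

* `knTheorem1_at_argmin` (R2′ at `|A| = 2`): `P(a₁↔b) ≤ P(a₂↔b) ⟹ P(v↔A, a₁↔b) ≤ P(v↔A, v↔b)`;
* `knTheorem1'`: KN Theorem 1 again (take the `a` with the smaller `P(a↔b)`);
* `knTheorem7_at_argmin` / `knTheorem7'`: the same for monotone cluster properties via R10f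
  (`orderPreserving_fun_of_nonneg`, after shifting `f` to be nonnegative).
-/

namespace Summit.Ventures.PercRepro2

section Argmin

variable {V : Type*} {E : Type*} [Fintype E] [DecidableEq E] [Fintype V] [DecidableEq V]
  {R : Type*} [Field R] [LinearOrder R] [IsStrictOrderedRing R]

omit [Fintype V] [DecidableEq V] [LinearOrder R] [IsStrictOrderedRing R] in
/-- Inclusion–exclusion for `P(X ∩ (C₁ ∪ C₂))`. -/
lemma prob_inter_union_eq (p : E → R) (X C₁ C₂ : Set (Config E)) :
    prob p (X ∩ (C₁ ∪ C₂)) = prob p (X ∩ C₁) + prob p (X ∩ C₂) - prob p (X ∩ C₁ ∩ C₂) := by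
  have h := prob_union_add_prob_inter p (X ∩ C₁) (X ∩ C₂)
  have e1 : X ∩ C₁ ∪ X ∩ C₂ = X ∩ (C₁ ∪ C₂) := (Set.inter_union_distrib_left X C₁ C₂).symm
  have e2 : X ∩ C₁ ∩ (X ∩ C₂) = X ∩ C₁ ∩ C₂ := by
    ext ω; simp only [Set.mem_inter_iff]; tauto
  rw [e1, e2] at h
  linear_combination h

omit [Fintype E] [DecidableEq E] [Fintype V] [DecidableEq V] in
/-- On `{v ↔ x}`, `{x ↔ b}` and `{v ↔ b}` coincide. -/
lemma connEvent_xb_inter_eq (ends : E → Sym2 V) (v x b : V) (A : Set (Config E)) :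
    connEvent ends x b ∩ (connEvent ends v x ∩ A) = connEvent ends v b ∩ (connEvent ends v x ∩ A) := by
  ext ω
  simp only [Set.mem_inter_iff, mem_connEvent]
  constructor
  · rintro ⟨h1, h2, h3⟩
    exact ⟨conn_trans h2 h1, h2, h3⟩
  · rintro ⟨h1, h2, h3⟩
    exact ⟨conn_trans (conn_symm h2) h1, h2, h3⟩

/-- **R2′ at `|A| = 2`** (Kozma–Nitzan (3) at the `b`-distance minimiser):
`P(a₁ ↔ b) ≤ P(a₂ ↔ b)` implies `P(v ↔ {a₁, a₂}, a₁ ↔ b) ≤ P(v ↔ {a₁, a₂}, v ↔ b)`. -/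
theorem knTheorem1_at_argmin (p : E → R) (hp : IsProbVec p) (ends : E → Sym2 V) (v b a₁ a₂ : V)
    (h : prob p (connEvent ends a₁ b) ≤ prob p (connEvent ends a₂ b)) :
    prob p (hitEvent ends v {a₁, a₂} ∩ connEvent ends a₁ b) ≤
      prob p (hitEvent ends v {a₁, a₂} ∩ connEvent ends v b) := by
  rw [hitEvent_pair, Set.inter_comm, Set.inter_comm (connEvent ends v a₁ ∪ connEvent ends v a₂),
    prob_inter_union_eq, prob_inter_union_eq]
  -- the terms on `{v ↔ a₁}` agree
  have e1 : connEvent ends a₁ b ∩ connEvent ends v a₁ = connEvent ends v b ∩ connEvent ends v a₁ := by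
    have := connEvent_xb_inter_eq ends v a₁ b Set.univ
    simpa only [Set.inter_univ] using this
  -- the term on `{v ↔ a₂}`: R10 at the root `a₂`
  have e2 : connEvent ends v b ∩ connEvent ends v a₂ = connEvent ends a₂ b ∩ connEvent ends v a₂ := by
    have := connEvent_xb_inter_eq ends v a₂ b Set.univ
    simpa only [Set.inter_univ] using this.symm
  have hR := orderPreserving_conn p hp ends a₂ a₁ b (isUpperSet_mem_setOf v) h
  rw [clusterInEvent_mem_eq_connEvent, Set.inter_comm, Set.inter_comm (connEvent ends v a₂)] at hR
  rw [e1, e2]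
  linarith

/-- **Kozma–Nitzan Theorem 1, second proof** (`KNTheorem1 R` via order preservation). -/
theorem knTheorem1_pair' (p : E → R) (hp : IsProbVec p) (ends : E → Sym2 V) (v b a₁ a₂ : V) :
    PreFKG p ends {a₁, a₂} (Finset.insert_nonempty a₁ {a₂}) v b := by
  unfold PreFKG
  rw [Set.inter_comm (connEvent ends v b)]
  rcases le_total (prob p (connEvent ends a₁ b)) (prob p (connEvent ends a₂ b)) with h | h
  · exact (Finset.inf'_le _ (Finset.mem_insert_self a₁ {a₂})).trans
      (knTheorem1_at_argmin p hp ends v b a₁ a₂ h)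
  · have := knTheorem1_at_argmin p hp ends v b a₂ a₁ h
    rw [Finset.pair_comm] at this
    exact (Finset.inf'_le _ (Finset.mem_insert_of_mem (Finset.mem_singleton_self a₂))).trans this

omit [Fintype V] [DecidableEq V] [LinearOrder R] [IsStrictOrderedRing R] in
/-- Inclusion–exclusion for `E[g 1_{C₁ ∪ C₂}]`. -/
lemma expect_mul_indicator_union (p : E → R) (g : Config E → R) (C₁ C₂ : Set (Config E)) :
    expect p (fun ω => g ω * (C₁ ∪ C₂).indicator 1 ω) =
      expect p (fun ω => g ω * C₁.indicator 1 ω) + expect p (fun ω => g ω * C₂.indicator 1 ω) -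
        expect p (fun ω => g ω * (C₁ ∩ C₂).indicator 1 ω) := by
  rw [← expect_add, ← expect_sub]
  congr 1
  funext ω
  simp only [Pi.add_apply, Pi.sub_apply]
  by_cases h1 : ω ∈ C₁ <;> by_cases h2 : ω ∈ C₂ <;> simp [h1, h2]

/-- **Conjecture 4 at `|A| = 2` at the `f`-minimiser, nonnegative case**:
`E f(a₁) ≤ E f(a₂)` implies `E(f(a₁); v ↔ A) ≤ E(f(v); v ↔ A)`. -/
theorem knTheorem7_at_argmin_of_nonneg (p : E → R) (hp : IsProbVec p) (ends : E → Sym2 V)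
    (v a₁ a₂ : V) {f : V → Config E → R} (hf : IsMonotoneClusterProperty ends f)
    (hf0 : ∀ x ω, 0 ≤ f x ω) (h : expect p (f a₁) ≤ expect p (f a₂)) :
    hitExpect p ends {a₁, a₂} v f a₁ ≤ hitExpect p ends {a₁, a₂} v f v := by
  unfold hitExpect
  rw [hitEvent_pair, expect_mul_indicator_union, expect_mul_indicator_union]
  -- the terms on `{v ↔ a₁}` agree
  have e1 : expect p (fun ω => f a₁ ω * (connEvent ends v a₁).indicator 1 ω) =
      expect p (fun ω => f v ω * (connEvent ends v a₁).indicator 1 ω) :=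
    expect_mul_indicator_congr p fun _ hω => (hf.eq_of_conn hω).symm
  have e3 : expect p (fun ω => f a₁ ω * (connEvent ends v a₁ ∩ connEvent ends v a₂).indicator 1 ω) =
      expect p (fun ω => f v ω * (connEvent ends v a₁ ∩ connEvent ends v a₂).indicator 1 ω) :=
    expect_mul_indicator_congr p fun _ hω => (hf.eq_of_conn hω.1).symm
  -- the term on `{v ↔ a₂}`: R10f at the root `a₂`
  have e2 : expect p (fun ω => f v ω * (connEvent ends v a₂).indicator 1 ω) =
      expect p (fun ω => f a₂ ω * (connEvent ends v a₂).indicator 1 ω) :=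
    expect_mul_indicator_congr p fun _ hω => hf.eq_of_conn hω
  have hR := orderPreserving_fun_of_nonneg p hp ends a₂ a₁ (isUpperSet_mem_setOf v) hf hf0 h
  rw [clusterInEvent_mem_eq_connEvent] at hR
  rw [e1, e3, e2]
  linarith

/-- **Conjecture 4 at `|A| = 2` at the `f`-minimiser** (any monotone cluster property). -/
theorem knTheorem7_at_argmin (p : E → R) (hp : IsProbVec p) (ends : E → Sym2 V) (v a₁ a₂ : V)
    {f : V → Config E → R} (hf : IsMonotoneClusterProperty ends f)
    (h : expect p (f a₁) ≤ expect p (f a₂)) :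
    hitExpect p ends {a₁, a₂} v f a₁ ≤ hitExpect p ends {a₁, a₂} v f v := by
  classical
  haveI : Nonempty (V × Config E) := ⟨(v, fun _ => false)⟩
  set m : R := Finset.univ.inf' Finset.univ_nonempty (fun xω : V × Config E => f xω.1 xω.2) with hm
  have hm_le : ∀ x ω, m ≤ f x ω := fun x ω =>
    Finset.inf'_le (fun xω : V × Config E => f xω.1 xω.2) (Finset.mem_univ (x, ω))
  have h' : expect p (fun ω => f a₁ ω - m) ≤ expect p (fun ω => f a₂ ω - m) := by
    have e : ∀ x, expect p (fun ω => f x ω - m) = expect p (f x) - m := by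
      intro x
      rw [show (fun ω => f x ω - m) = f x - fun _ => m from rfl, expect_sub, expect_const]
    rw [e, e]
    linarith
  have := knTheorem7_at_argmin_of_nonneg p hp ends v a₁ a₂ (isMonotoneClusterProperty_sub_const hf m)
    (fun x ω => sub_nonneg.2 (hm_le x ω)) h'
  rw [hitExpect_sub_const, hitExpect_sub_const] at this
  linarith

/-- **Kozma–Nitzan Theorem 7, second proof**: Conjecture 4 at `A = {a₁, a₂}` via R10f. -/
theorem knTheorem7_pair' (p : E → R) (hp : IsProbVec p) (ends : E → Sym2 V) (v a₁ a₂ : V)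
    {f : V → Config E → R} (hf : IsMonotoneClusterProperty ends f) :
    KNConjecture4 p ends {a₁, a₂} (Finset.insert_nonempty a₁ {a₂}) v f := by
  unfold KNConjecture4
  rcases le_total (expect p (f a₁)) (expect p (f a₂)) with h | h
  · exact (Finset.inf'_le _ (Finset.mem_insert_self a₁ {a₂})).trans
      (knTheorem7_at_argmin p hp ends v a₁ a₂ hf h)
  · have := knTheorem7_at_argmin p hp ends v a₂ a₁ hf h
    rw [Finset.pair_comm] at this
    exact (Finset.inf'_le _ (Finset.mem_insert_of_mem (Finset.mem_singleton_self a₂))).trans this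

end Argmin

section ArgminClosures

variable (R : Type) [Field R] [LinearOrder R] [IsStrictOrderedRing R]

/-- `KNTheorem1 R`, second proof (order preservation). -/
theorem knTheorem1' : KNTheorem1 R := by
  intro V E _ _ _ _ ends p hp v b a₁ a₂
  exact knTheorem1_pair' p hp ends v b a₁ a₂

/-- `KNTheorem7 R`, second proof (order preservation for cluster properties). -/
theorem knTheorem7' : KNTheorem7 R := by
  intro V E _ _ _ _ ends p hp v a₁ a₂ f hf
  exact knTheorem7_pair' p hp ends v a₁ a₂ hf

end ArgminClosures

end Summit.Ventures.PercRepro2
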